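import Summits.QuantumFields.YangMills.Theorems.FluctuationComparisonRegPrIntLS2BetaSignedCombKill
import Summits.QuantumFields.YangMills.Theorems.FluctuationComparisonRegPrIntLWregChain
import Literature.MathematicalPhysics.QuantumFieldTheory.Balaban1983to89.Node00.AveragingSkewPresentation
import Literature.MathematicalPhysics.QuantumFieldTheory.Balaban1983to89.B10StarCount
import HarnessLib

/-!
# (C3-c) III — the comb set: PIVOTS ARE NOT COMB BONDS, and THE COUNT `#comb = #sites − #centres`

Crux `stmt-QuantumFields-20520` (`…Theses.UnitScaleTilt.FluctuationComparisonRegPrIntL`), LINE g18-1 S2β LAPLACE, organ (C3).  Two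
bookkeeping facts about the comb set `combSet k` of (C3-c) II needed to instantiate the generic tree-gauge chart
(`…S2BetaTreeGaugeChart.exists_tubularChart_of_treeGauge`, p736010) on the OFF-PIVOT bonds and to match the dimensions of the (C3β″)
letter `exists_tubularHaarChart_act` (`dZ = 3·((#T_η − #T⁽ᵏ⁾) + #bonds⁽ᵏ⁾)`, `dV = 3·(#bonds_η − #bonds⁽ᵏ⁾) − 3·(#T_η − #T⁽ᵏ⁾)`):

* `iterCentralBond_not_mem_combSet`: the pivots `βₖ(c)` (`…WregChain.iterCentralBond k c`) are INTER-`k`-block bonds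
  (`blockIter_iterCentralBond`: `Bᵏ(βₖ(c)₋) = c₋ ≠ c₊ = Bᵏ(βₖ(c)₊)`), whereas comb bonds lie inside one `k`-block;
* `combSetEquivNonRoot` ∕ `nat_card_combSet`: the comb bonds are in bijection with the non-central sites (far end point ↔ last bond of
  the comb path), so `#combSet k = #Site P 0 − #Site P k` — the tree has one bond per non-root vertex.

Bookkeeping only ([Balaban1985Variational] (19) p.281 «axial gauge in blocks», (181) p.307; [Balaban1987RG1] (0.1)–(0.4) pp.251–253);
nothing printed is asserted as a fact.
-/

open Function
open Literature.MathematicalPhysics.QuantumFieldTheory.Balaban1983to89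
open Literature.MathematicalPhysics.QuantumFieldTheory.Balaban1983to89.T4RootedResidualGauge (rootOf rootOf_embIter blockIter_rootOf)
open Literature.MathematicalPhysics.QuantumFieldTheory.Balaban1983to89.B15DeterminingSets (embIter)
open Literature.MathematicalPhysics.QuantumFieldTheory.Balaban1983to89.B14.Eq22Determines (blockIter blockIter_zero blockIter_succ)
open Literature.MathematicalPhysics.QuantumFieldTheory.Balaban1983to89.B15Eq177GaugeInvariance (blockIter_embIter)
open Literature.MathematicalPhysics.QuantumFieldTheory.Balaban1983to89.BlockAveragingHaarAC (centralBond)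
open Literature.MathematicalPhysics.QuantumFieldTheory.Balaban1983to89.Node00 (blockOf_centralBond_src blockOf_centralBond_tgt)
open Literature.MathematicalPhysics.QuantumFieldTheory.Balaban1983to89.B10StarCount (shift_unshift unshift_shift)
open Summit.QuantumFields.YangMills.Theorems.FluctuationComparisonRegPrIntLWregChain (iterCentralBond iterCentralBond_succ)
open Summit.QuantumFields.YangMills.Theorems.FluctuationComparisonRegPrIntLS2BetaSignedCombKill

namespace Summit.QuantumFields.YangMills.Theorems.FluctuationComparisonRegPrIntLS2BetaSignedCombCount

variable {P : Params} {k : ℕ}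

/-! ## §1  Pivots are inter-block bonds, hence not comb bonds -/

/-- The end points of the iterated central bond `βₙ(c)` lie in the `n`-blocks of the end points of `c`: `Bⁿ(βₙ(c)₋) = c₋`, `Bⁿ(βₙ(c)₊) = c₊`
(standing range). [cite: Balaban1987RG1, (0.4) p.253 (bookkeeping)] -/
theorem blockIter_iterCentralBond : ∀ {n : ℕ}, n ≤ P.m + P.K → ∀ c : PBond P n,
    blockIter n (iterCentralBond n c).src = c.src ∧ blockIter n (iterCentralBond n c).tgt = c.tgt
  | 0, _, _ => ⟨rfl, rfl⟩
  | n + 1, hn, c => by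
      rw [iterCentralBond_succ, blockIter_succ, blockIter_succ]
      obtain ⟨hs, ht⟩ := blockIter_iterCentralBond (n := n) (by omega) (centralBond c)
      rw [hs, ht]
      exact ⟨blockOf_centralBond_src hn c, blockOf_centralBond_tgt hn c⟩

/-- ★ PIVOTS ARE NOT COMB BONDS: `βₖ(c) ∉ combSet k` (a comb bond lies inside one `k`-block, a pivot crosses between two). [cite: Balaban1987RG1, (0.4) p.253 (bookkeeping)] -/
theorem iterCentralBond_not_mem_combSet (hk : k ≤ P.m + P.K) (c : PBond P k) :
    iterCentralBond k c ∉ (combSet k : Set (PBond P 0)) := by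
  intro h
  obtain ⟨hs, ht⟩ := blockIter_iterCentralBond hk c
  have h1 := h.1
  rw [hs, ht] at h1
  -- `c₊ = c₋ + e_μ ≠ c₋` (`1 ≠ 0` in `ZMod (2L^{m+K−k})`)
  have h2 := congrFun h1 c.dir
  simp only [PBond.tgt, Site.shift, Function.update_self] at h2
  exact one_ne_zero (add_eq_left.1 h2.symm)

/-! ## §2  Centres, non-central sites -/

/-- The roots are exactly the `k`-centres: `root x = x ↔ x ∈ ιᵏ(T⁽ᵏ⁾)`. [cite: Balaban1987RG1, (0.1) p.251 (bookkeeping)] -/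
theorem rootOf_eq_self_iff (hk : k ≤ P.m + P.K) (x : Site P 0) :
    rootOf k x = x ↔ x ∈ Set.range (embIter k : Site P k → Site P 0) :=
  ⟨fun h => ⟨blockIter k x, h⟩, fun ⟨y, hy⟩ => by rw [← hy]; exact rootOf_embIter hk y⟩

/-- The centres are in bijection with `T⁽ᵏ⁾`. [cite: Balaban1987RG1, (0.1) p.251 (bookkeeping)] -/
def rootsEquiv (hk : k ≤ P.m + P.K) : {x : Site P 0 // rootOf k x = x} ≃ Site P k where
  toFun x := blockIter k x.1
  invFun y := ⟨embIter k y, rootOf_embIter hk y⟩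
  left_inv x := Subtype.ext x.2
  right_inv y := blockIter_embIter k hk y

/-- `#{non-central sites} = #T_η − #T⁽ᵏ⁾`. [cite: Balaban1987RG1, (0.1) p.251 (bookkeeping)] -/
theorem card_nonRoot (hk : k ≤ P.m + P.K) :
    Fintype.card {x : Site P 0 // rootOf k x ≠ x} = Fintype.card (Site P 0) - Fintype.card (Site P k) := by
  rw [Fintype.card_subtype_compl, Fintype.card_congr (rootsEquiv hk)]

/-! ## §3  Block arithmetic for one step back ∕ forth (`shift_unshift`, `unshift_shift` from `B10StarCount`) -/

/-- A label in the `Lᵏ`-range of `x_μ` has the block index of `x_μ`. [cite: Balaban1987RG1, (0.1) p.251 (bookkeeping)] -/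
theorem div_eq_of_mem_range (x : Site P 0) (μ : Fin P.d) {v : ℕ} (hlo : (x μ).val / P.L ^ k * P.L ^ k ≤ v)
    (hhi : v < (x μ).val / P.L ^ k * P.L ^ k + P.L ^ k) : v / P.L ^ k = (x μ).val / P.L ^ k :=
  Nat.div_eq_of_lt_le hlo (by rw [Nat.succ_mul]; exact hhi)

/-- ONE STEP BACK ABOVE THE CENTRE stays in the block: if `(root x)_μ < x_μ` then `(x − e_μ)_μ = x_μ − 1` and `Bᵏ(x − e_μ) = Bᵏ x`.
[cite: Balaban1987RG1, (0.1) p.251 (bookkeeping)] -/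
theorem unshift_of_lt (hk : k ≤ P.m + P.K) {x : Site P 0} {μ : Fin P.d} (h : (rootOf k x μ).val < (x μ).val) :
    ((x.unshift μ) μ).val = (x μ).val - 1 ∧ blockIter k (x.unshift μ) = blockIter k x := by
  have hr := val_rootOf hk x μ
  have hx : (x μ).val < P.sitesPerDir 0 := ZMod.val_lt _
  have hv : ((x.unshift μ) μ).val = (x μ).val - 1 := by
    have hu : (x.unshift μ) μ = (((x μ).val - 1 : ℕ) : ZMod (P.sitesPerDir 0)) := by
      simp only [Site.unshift, Function.update_self]
      rw [Nat.cast_sub (by omega), Nat.cast_one, ZMod.natCast_zmod_val]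
    rw [hu, ZMod.val_natCast, Nat.mod_eq_of_lt (by omega)]
  refine ⟨hv, (blockIter_eq_iff hk _ _).2 fun ν => ?_⟩
  by_cases hν : ν = μ
  · subst hν
    rw [hv]
    exact div_eq_of_mem_range x ν (by omega) (by have := Nat.lt_div_mul_add (a := (x ν).val) (pow_pos P.L_pos k); omega)
  · simp only [Site.unshift, Function.update_of_ne hν]

/-- ONE STEP FORTH BELOW THE CENTRE stays in the block: if `x_μ < (root x)_μ` then `(x + e_μ)_μ = x_μ + 1` and `Bᵏ(x + e_μ) = Bᵏ x`.
[cite: Balaban1987RG1, (0.1) p.251 (bookkeeping)] -/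
theorem shift_of_lt (hk : k ≤ P.m + P.K) {x : Site P 0} {μ : Fin P.d} (h : (x μ).val < (rootOf k x μ).val) :
    ((x.shift μ) μ).val = (x μ).val + 1 ∧ blockIter k (x.shift μ) = blockIter k x := by
  have hr := val_rootOf hk x μ
  have hrN : (rootOf k x μ).val < P.sitesPerDir 0 := ZMod.val_lt _
  obtain ⟨c, hc⟩ : Odd (P.L ^ k) := P.hL.1.pow
  have hv : ((x.shift μ) μ).val = (x μ).val + 1 := by
    have hu : (x.shift μ) μ = (((x μ).val + 1 : ℕ) : ZMod (P.sitesPerDir 0)) := by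
      simp only [Site.shift, Function.update_self]
      rw [Nat.cast_add, Nat.cast_one, ZMod.natCast_zmod_val]
    rw [hu, ZMod.val_natCast, Nat.mod_eq_of_lt (by omega)]
  refine ⟨hv, (blockIter_eq_iff hk _ _).2 fun ν => ?_⟩
  by_cases hν : ν = μ
  · subst hν
    rw [hv]
    refine div_eq_of_mem_range x ν (by have := Nat.div_mul_le_self (x ν).val (P.L ^ k); omega) ?_
    have hh : (P.L ^ k - 1) / 2 = c := by omega
    rw [hh] at hr
    omega
  · simp only [Site.shift, Function.update_of_ne hν]

/-! ## §4  The far end point of a comb bond and the last comb bond of a non-central site -/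

/-- The FAR end point (from the block centre) of a bond: `b₊` if `b₋` is at or above the centre in direction `μ(b)`, else `b₋`. [cite: Balaban1985Variational, (19) p.281 (bookkeeping)] -/
def far (k : ℕ) (b : PBond P 0) : Site P 0 := if (rootOf k b.src b.dir).val ≤ (b.src b.dir).val then b.tgt else b.src

/-- The directions in which `x` differs from its block centre. [cite: Balaban1985Variational, (19) p.281 (bookkeeping)] -/
def diffDirs (k : ℕ) (x : Site P 0) : Finset (Fin P.d) := Finset.univ.filter fun ν => x ν ≠ rootOf k x ν

/-- A non-central site differs from its centre in some direction. [cite: Balaban1985Variational, (19) p.281 (bookkeeping)] -/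
theorem diffDirs_nonempty {x : Site P 0} (hx : rootOf k x ≠ x) : (diffDirs k x).Nonempty := by
  by_contra h
  rw [Finset.not_nonempty_iff_eq_empty, diffDirs, Finset.filter_eq_empty_iff] at h
  exact hx (funext fun ν => (not_not.1 (h (Finset.mem_univ ν))).symm)

/-- The LAST direction in which a non-central site differs from its centre (the direction of the last bond of its comb path).
[cite: Balaban1985Variational, (19) p.281 (bookkeeping)] -/
def lastDir (k : ℕ) (x : Site P 0) (hx : rootOf k x ≠ x) : Fin P.d := (diffDirs k x).max' (diffDirs_nonempty hx)

/-- Defining properties of the last differing direction. [cite: Balaban1985Variational, (19) p.281 (bookkeeping)] -/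
theorem lastDir_spec {x : Site P 0} (hx : rootOf k x ≠ x) :
    x (lastDir k x hx) ≠ rootOf k x (lastDir k x hx) ∧ ∀ ν, lastDir k x hx < ν → x ν = rootOf k x ν := by
  refine ⟨(Finset.mem_filter.1 (Finset.max'_mem _ (diffDirs_nonempty hx))).2, fun ν hν => ?_⟩
  by_contra hne
  exact (not_le.2 hν) (Finset.le_max' _ ν (Finset.mem_filter.2 ⟨Finset.mem_univ ν, hne⟩))

/-- Characterisation of the last differing direction. [cite: Balaban1985Variational, (19) p.281 (bookkeeping)] -/
theorem lastDir_eq {x : Site P 0} (hx : rootOf k x ≠ x) {μ : Fin P.d} (h1 : x μ ≠ rootOf k x μ)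
    (h2 : ∀ ν, μ < ν → x ν = rootOf k x ν) : lastDir k x hx = μ := by
  refine le_antisymm ?_ (Finset.le_max' _ μ (Finset.mem_filter.2 ⟨Finset.mem_univ μ, h1⟩))
  by_contra hlt
  exact (lastDir_spec hx).1 (h2 _ (not_le.1 hlt))

/-- THE LAST COMB BOND of a non-central site: one step back from `x` in its last differing direction if `x` is above the centre there,
the bond at `x` itself if below. [cite: Balaban1985Variational, (19) p.281 (bookkeeping)] -/
def toBond (k : ℕ) (x : Site P 0) (hx : rootOf k x ≠ x) : PBond P 0 :=
  if (rootOf k x (lastDir k x hx)).val < (x (lastDir k x hx)).val then ⟨x.unshift (lastDir k x hx), lastDir k x hx⟩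
  else ⟨x, lastDir k x hx⟩

/-- `toBond` through a known last direction. [cite: Balaban1985Variational, (19) p.281 (bookkeeping)] -/
theorem toBond_eq {x : Site P 0} (hx : rootOf k x ≠ x) {μ : Fin P.d} (h : lastDir k x hx = μ) :
    toBond k x hx = if (rootOf k x μ).val < (x μ).val then ⟨x.unshift μ, μ⟩ else ⟨x, μ⟩ := by
  unfold toBond; rw [h]

/-- The far end point of a comb bond is not a centre. [cite: Balaban1985Variational, (19) p.281 (bookkeeping)] -/
theorem rootOf_far_ne (hk : k ≤ P.m + P.K) {b : PBond P 0} (hb : b ∈ (combSet k : Set (PBond P 0))) :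
    rootOf k (far k b) ≠ far k b := by
  unfold far
  split_ifs with h
  · rw [← rootOf_eq_of_blockIter_eq hb.1]
    intro hE
    have h1 : ((b.tgt b.dir).val : ℤ) = ((rootOf k b.src b.dir).val : ℤ) := by rw [hE]
    rw [show b.tgt = b.src.shift b.dir from rfl, val_shift_of_blockIter_eq hk hb.1] at h1
    have h2 : ((rootOf k b.src b.dir).val : ℤ) ≤ (b.src b.dir).val := by exact_mod_cast h
    omega
  · intro hE
    exact h (le_of_eq (by rw [hE]))

/-- The last comb bond of a non-central site is a comb bond. [cite: Balaban1985Variational, (19) p.281 (bookkeeping)] -/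
theorem toBond_mem (hk : k ≤ P.m + P.K) {x : Site P 0} (hx : rootOf k x ≠ x) : toBond k x hx ∈ (combSet k : Set (PBond P 0)) := by
  obtain ⟨h1, h2⟩ := lastDir_spec hx
  rw [toBond_eq hx rfl]
  split_ifs with hlt
  · -- one step back above the centre
    obtain ⟨_, hblk⟩ := unshift_of_lt hk hlt
    refine ⟨?_, fun ν hν => ?_⟩
    · show blockIter k (x.unshift (lastDir k x hx)) = blockIter k ((x.unshift (lastDir k x hx)).shift (lastDir k x hx))
      rw [shift_unshift, hblk]
    · show (x.unshift (lastDir k x hx)) ν = rootOf k (x.unshift (lastDir k x hx)) ν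
      rw [rootOf_eq_of_blockIter_eq hblk]
      simp only [Site.unshift, Function.update_of_ne hν.ne']
      exact h2 ν hν
  · -- the bond at `x`, below the centre
    have hlt' : (x (lastDir k x hx)).val < (rootOf k x (lastDir k x hx)).val :=
      lt_of_le_of_ne (not_lt.1 hlt) fun hE => h1 (ZMod.val_injective _ hE)
    obtain ⟨_, hblk⟩ := shift_of_lt hk hlt'
    exact ⟨hblk.symm, fun ν hν => h2 ν hν⟩

/-- `far ∘ toBond = id`. [cite: Balaban1985Variational, (19) p.281 (bookkeeping)] -/
theorem far_toBond (hk : k ≤ P.m + P.K) {x : Site P 0} (hx : rootOf k x ≠ x) : far k (toBond k x hx) = x := by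
  obtain ⟨h1, _⟩ := lastDir_spec hx
  rw [toBond_eq hx rfl]
  split_ifs with hlt
  · obtain ⟨hv, hblk⟩ := unshift_of_lt hk hlt
    unfold far
    rw [if_pos, show (⟨x.unshift (lastDir k x hx), lastDir k x hx⟩ : PBond P 0).tgt = (x.unshift (lastDir k x hx)).shift (lastDir k x hx)
      from rfl, shift_unshift]
    show (rootOf k (x.unshift (lastDir k x hx)) (lastDir k x hx)).val ≤ ((x.unshift (lastDir k x hx)) (lastDir k x hx)).val
    rw [rootOf_eq_of_blockIter_eq hblk, hv]
    omega
  · unfold far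
    rw [if_neg]
    show ¬ (rootOf k x (lastDir k x hx)).val ≤ (x (lastDir k x hx)).val
    exact fun hle => h1 (ZMod.val_injective _ (le_antisymm (not_lt.1 hlt) hle))

/-- `toBond ∘ far = id` on the comb set. [cite: Balaban1985Variational, (19) p.281 (bookkeeping)] -/
theorem toBond_far (hk : k ≤ P.m + P.K) {b : PBond P 0} (hb : b ∈ (combSet k : Set (PBond P 0))) (hx : rootOf k (far k b) ≠ far k b) :
    toBond k (far k b) hx = b := by
  obtain ⟨y, μ⟩ := b
  obtain ⟨hblk, hlater⟩ := hb
  have hroot : rootOf k (y.shift μ) = rootOf k y := (rootOf_eq_of_blockIter_eq hblk).symm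
  have hwrap := val_shift_of_blockIter_eq hk hblk
  simp only at hblk hlater hroot hwrap hx ⊢
  by_cases h : (rootOf k y μ).val ≤ (y μ).val
  · -- far end = `y + e_μ`
    have hfar : far k ⟨y, μ⟩ = y.shift μ := if_pos h
    have hx' : rootOf k (y.shift μ) ≠ y.shift μ := by rw [← hfar]; exact hx
    have hval : ((y.shift μ) μ).val = (y μ).val + 1 := by exact_mod_cast hwrap
    have hdir : lastDir k (y.shift μ) hx' = μ := by
      refine lastDir_eq hx' ?_ fun ν hν => ?_
      · rw [hroot]; intro hE; have := congrArg ZMod.val hE; omega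
      · rw [hroot]; simp only [Site.shift, Function.update_of_ne hν.ne']; exact hlater ν hν
    have key : toBond k (y.shift μ) hx' = ⟨y, μ⟩ := by
      rw [toBond_eq hx' hdir, if_pos (by rw [hroot, hval]; omega), unshift_shift]
    convert key using 2
  · have hfar : far k ⟨y, μ⟩ = y := if_neg h
    have hx' : rootOf k y ≠ y := by rw [← hfar]; exact hx
    have hdir : lastDir k y hx' = μ := by
      refine lastDir_eq hx' (fun hE => h (le_of_eq (by rw [hE]))) fun ν hν => hlater ν hν
    have key : toBond k y hx' = ⟨y, μ⟩ := by
      rw [toBond_eq hx' hdir, if_neg (by omega)]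
    convert key using 2

/-- ★★ THE COMB BONDS ARE IN BIJECTION WITH THE NON-CENTRAL SITES (far end point ↔ last comb bond): the comb is a spanning forest of the
blocks rooted at the centres, one bond per non-root vertex. [cite: Balaban1985Variational, (19) p.281 (bookkeeping)] -/
noncomputable def combSetEquivNonRoot (hk : k ≤ P.m + P.K) :
    ↥(combSet k : Set (PBond P 0)) ≃ {x : Site P 0 // rootOf k x ≠ x} where
  toFun b := ⟨far k b.1, rootOf_far_ne hk b.2⟩
  invFun x := ⟨toBond k x.1 x.2, toBond_mem hk x.2⟩
  left_inv b := Subtype.ext (toBond_far hk b.2 _)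
  right_inv x := Subtype.ext (far_toBond hk x.2)

/-- ★★ THE COUNT: `#combSet k = #T_η − #T⁽ᵏ⁾`. [cite: Balaban1985Variational, (19) p.281 (bookkeeping)] -/
theorem nat_card_combSet (hk : k ≤ P.m + P.K) :
    Nat.card ↥(combSet k : Set (PBond P 0)) = Fintype.card (Site P 0) - Fintype.card (Site P k) := by
  rw [Nat.card_congr (combSetEquivNonRoot hk), Nat.card_eq_fintype_card, card_nonRoot hk]

end Summit.QuantumFields.YangMills.Theorems.FluctuationComparisonRegPrIntLS2BetaSignedCombCount
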